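import Mathlib
import Summits.Ventures.PercRepro.TriangleCapFiveBelowConvex

/-!
# PercRepro — FIVE BELOW THE DIAGONAL IS EXACT ON THE `K₄⁻`-FREE CLASS FOR THE CELLS `m = 3 (k − 3) − 5`, EVERY
`k ≥ 11` (p3, gen 40; part 150)

The sub-diagonal `r = 5` of the closed form on its `a = 3` cells `(11, 19) 73 · (12, 22) 95 · (13, 25) 120 · …`,
by the degree argument of parts 147–149 alone — no triangle configuration:
* `dense_stability_four_three_ten`: the `r = 4` stability of the `a = 3` cells `m = 3k − 13` on EVERY vertex type
  with `k ≥ 10` (part 147 at `k = 10`, the assembly and residue of parts 144–145 from `k = 11` on);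
* a vertex of degree `0 / 1 / 2` is deleted onto the cells `r = 2 / 3 / 4` of the row `a = 3` at `k − 1`
  (`stability_five_three_of_isolated` / `_of_pendant` / `_of_degree_two`: the slack is `8`, `2k − 2 d(x) ≥ 0`,
  `4k − 12 − 2 (d(x) + d(y)) ≥ 0` by the pair lemma);
* every degree `≥ 3` is the convexity bound of part 149.
`dense_stability_five_three`: `K₄⁻`-free, `k ≥ 11`, `m + 14 = 3k` ⇒ `Σ_v d(v)² + 5 (k − 6) ≤ m k`;
**`five_below_diagonal_exact_k4m_three`**: for every `k ≥ 11` the maximum of `2·Σ_v C(d(v), 2)` over the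
`K₄⁻`-free graphs on `Fin k` with `3 (k − 3) − 5` edges is `(3 (k − 3) − 5)(k − 2) − 5 (k − 6)`, attained by
`K_{3, k−3}` minus five edges at one vertex. Axioms: standard.
-/

namespace PercRepro

namespace TriangleCap

namespace C047

open Finset

variable {V : Type*} [Fintype V] [DecidableEq V]

/-- **THE `r = 4` STABILITY OF THE `a = 3` CELLS ON EVERY VERTEX TYPE, `k ≥ 10`:** `K₄⁻`-free, `m + 13 = 3k`
⇒ `Σ_v d(v)² + 4 (k − 5) ≤ m k`. -/
theorem dense_stability_four_three_ten (D : SimpleGraph V) [DecidableRel D.Adj] (hK : K4mFree D)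
    (hk : 10 ≤ Fintype.card V) (hm : D.edgeFinset.card + 13 = 3 * Fintype.card V) :
    ∑ v, deg D v * deg D v + 4 * (Fintype.card V - 5) ≤ D.edgeFinset.card * Fintype.card V := by
  rcases Nat.lt_or_ge (Fintype.card V) 11 with h10 | h11
  · exact dense_stability_four_ten_seventeen D hK (by omega) (by omega)
  · have hprod : ∀ a', a' ≤ Fintype.card V → D.edgeFinset.card ≠ a' * (Fintype.card V - a') ∧
        D.edgeFinset.card + 1 ≠ a' * (Fintype.card V - a') ∧
        D.edgeFinset.card + 2 ≠ a' * (Fintype.card V - a') ∧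
        D.edgeFinset.card + 3 ≠ a' * (Fintype.card V - a') := by
      intro a' ha'
      have h := products_avoid (Fintype.card V) 3 (by norm_num) (by omega) a' ha'
      have e1 : 3 * (Fintype.card V - 3) - 4 = D.edgeFinset.card := by omega
      have e2 : 3 * (Fintype.card V - 3) - 3 = D.edgeFinset.card + 1 := by omega
      have e3 : 3 * (Fintype.card V - 3) - 2 = D.edgeFinset.card + 2 := by omega
      have e4 : 3 * (Fintype.card V - 3) - 1 = D.edgeFinset.card + 3 := by omega
      rw [e1, e2, e3, e4] at h
      exact h
    apply dense_stability_four_modulo_few_outer_eleven D hK h11 (by omega) hprod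
    intro u v w huv huw hvw hT hdeg _ hor
    have hq : ((({u, v, w} : Finset V)ᶜ).filter (fun z => degIn D {u, v, w} z = 0)).card ≤ 4 := by
      rcases hor with hq | hq
      · exact hq
      · omega
    exact residue_of_largest D 4
      (fun u v w huv huw hvw hT hmv hmw hq =>
        one_triangle_residue_three_eleven D hK huv huw hvw hT h11 hdeg hmv hmw hm hq)
      huv huw hvw hT hq

/-- No bipartition of a graph on `k' ≥ 10` vertices with `3k' − 11 − j` edges (`j ≤ 2`) has `≤ 3 − j` missing
pairs: the numbers `3k' − 13, …, 3k' − 10` are not products `a′ (k′ − a′)`. -/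
theorem not_bip_of_three_row (D : SimpleGraph V) [DecidableRel D.Adj] (hk : 10 ≤ Fintype.card V) (N : ℕ)
    (hN : N ≤ 3) (hm : D.edgeFinset.card + N + 10 = 3 * Fintype.card V) :
    ¬ ∃ A : Finset V, (∀ x y, D.Adj x y → (x ∈ A ↔ y ∉ A)) ∧ (missing D A Aᶜ).card ≤ N := by
  rintro ⟨A, hA, hN'⟩
  have hNX := card_missing_add_card_edges D A hA
  have hXc : Aᶜ.card = Fintype.card V - A.card := by
    have := card_add_card_compl A
    omega
  have hXk : A.card ≤ Fintype.card V := card_le_univ A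
  rw [hXc] at hNX
  have h := products_avoid (Fintype.card V) 3 (by norm_num) (by omega) A.card hXk
  obtain ⟨h1, h2, h3, h4⟩ := h
  have e1 : 3 * (Fintype.card V - 3) - 4 = 3 * Fintype.card V - 13 := by omega
  have e2 : 3 * (Fintype.card V - 3) - 3 = 3 * Fintype.card V - 12 := by omega
  have e3 : 3 * (Fintype.card V - 3) - 2 = 3 * Fintype.card V - 11 := by omega
  have e4 : 3 * (Fintype.card V - 3) - 1 = 3 * Fintype.card V - 10 := by omega
  rw [e1] at h1
  rw [e2] at h2
  rw [e3] at h3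
  rw [e4] at h4
  have : (missing D A Aᶜ).card + D.edgeFinset.card = 3 * Fintype.card V - 13 ∨
      (missing D A Aᶜ).card + D.edgeFinset.card = 3 * Fintype.card V - 12 ∨
      (missing D A Aᶜ).card + D.edgeFinset.card = 3 * Fintype.card V - 11 ∨
      (missing D A Aᶜ).card + D.edgeFinset.card = 3 * Fintype.card V - 10 := by omega
  rcases this with h | h | h | h
  · exact h1 (by omega)
  · exact h2 (by omega)
  · exact h3 (by omega)
  · exact h4 (by omega)

/-- **AN ISOLATED VERTEX** on the cell `m = 3k − 14`, `k ≥ 11`: deletion onto the `r = 2` cell at `k − 1`. -/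
theorem stability_five_three_of_isolated (D : SimpleGraph V) [DecidableRel D.Adj] (hK : K4mFree D)
    (hk : 11 ≤ Fintype.card V) (hm : D.edgeFinset.card + 14 = 3 * Fintype.card V) {z : V} (hz : deg D z = 0) :
    ∑ v, deg D v * deg D v + 5 * (Fintype.card V - 6) ≤ D.edgeFinset.card * Fintype.card V := by
  have hz' := hz
  unfold deg at hz'
  rw [card_eq_zero] at hz'
  have hnb : ∀ w, ¬ D.Adj z w := by
    intro w hw
    have : w ∈ univ.filter (fun w => D.Adj z w) := mem_filter.mpr ⟨mem_univ w, hw⟩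
    rw [hz'] at this
    exact absurd this (notMem_empty w)
  have hcard := card_del z
  have hedges := card_edges_del D z
  rw [hz] at hedges
  have hsq := sum_deg_sq_del D z
  rw [hz] at hsq
  have hsum1 : ∑ a : {v : V // v ≠ z}, (if D.Adj a.1 z then deg (del D z) a else 0) = 0 := by
    apply sum_eq_zero
    intro a _
    have : ¬ D.Adj a.1 z := fun h => hnb a.1 (D.adj_symm h)
    simp only [this, if_false]
  rw [hsum1] at hsq
  have hK' := k4mFree_del D hK z
  have hnot := not_bip_of_three_row (del D z) (by omega) 1 (by norm_num) (by omega)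
  have h := dense_stability_two_of_ten (del D z) hK' (by omega) (by omega) hnot
  obtain ⟨k', hk'⟩ : ∃ k', Fintype.card {v : V // v ≠ z} = k' := ⟨_, rfl⟩
  obtain ⟨m', hm'⟩ : ∃ m', (del D z).edgeFinset.card = m' := ⟨_, rfl⟩
  rw [hk'] at hcard h
  rw [hm'] at hedges h
  have hkV : Fintype.card V = k' + 1 := by omega
  have hmD : D.edgeFinset.card = m' := by omega
  rw [hkV, hmD]
  rw [hkV] at hm
  obtain ⟨j, hj⟩ : ∃ j, k' = j + 10 := ⟨k' - 10, by omega⟩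
  subst hj
  have e1 : j + 10 - 3 = j + 7 := by omega
  have e2 : j + 10 + 1 - 6 = j + 5 := by omega
  rw [e1] at h
  rw [e2]
  nlinarith

/-- **A PENDANT VERTEX** on the cell `m = 3k − 14`, `k ≥ 11`: deletion onto the `r = 3` cell at `k − 1`. -/
theorem stability_five_three_of_pendant (D : SimpleGraph V) [DecidableRel D.Adj] (hK : K4mFree D)
    (hk : 11 ≤ Fintype.card V) (hm : D.edgeFinset.card + 14 = 3 * Fintype.card V) {z : V} (hz : deg D z = 1) :
    ∑ v, deg D v * deg D v + 5 * (Fintype.card V - 6) ≤ D.edgeFinset.card * Fintype.card V := by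
  have hz' := hz
  unfold deg at hz'
  obtain ⟨x, hx⟩ := card_eq_one.mp hz'
  have hzx : D.Adj z x := by
    have : x ∈ univ.filter (fun w => D.Adj z w) := by rw [hx]; exact mem_singleton_self x
    exact (mem_filter.mp this).2
  have hnb : ∀ w, D.Adj z w → w = x := by
    intro w hw
    have : w ∈ univ.filter (fun w => D.Adj z w) := mem_filter.mpr ⟨mem_univ w, hw⟩
    rw [hx, mem_singleton] at this
    exact this
  have hxz : x ≠ z := hzx.ne.symm
  have hcard := card_del z
  have hedges := card_edges_del D z
  rw [hz] at hedges
  have hsq := sum_deg_sq_del D z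
  rw [hz] at hsq
  have hsum1 : ∑ a : {v : V // v ≠ z}, (if D.Adj a.1 z then deg (del D z) a else 0) =
      deg (del D z) ⟨x, hxz⟩ := by
    rw [sum_eq_single ⟨x, hxz⟩]
    · simp only [D.adj_symm hzx, if_true]
    · intro a _ ha
      have : ¬ D.Adj a.1 z := fun h => ha (Subtype.ext (hnb a.1 (D.adj_symm h)))
      simp only [this, if_false]
    · intro h; exact absurd (mem_univ _) h
  rw [hsum1] at hsq
  have hdx := deg_del D z ⟨x, hxz⟩
  simp only [D.adj_symm hzx, if_true] at hdx
  have hxk := deg_add_one_le_card D x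
  have hK' := k4mFree_del D hK z
  have hnot := not_bip_of_three_row (del D z) (by omega) 2 (by norm_num) (by omega)
  have h := dense_stability_three_of_ten (del D z) hK' (by omega) (by omega) (by omega) (Or.inr (Or.inl (by omega)))
    hnot
  obtain ⟨k', hk'⟩ : ∃ k', Fintype.card {v : V // v ≠ z} = k' := ⟨_, rfl⟩
  obtain ⟨m', hm'⟩ : ∃ m', (del D z).edgeFinset.card = m' := ⟨_, rfl⟩
  obtain ⟨d', hd'⟩ : ∃ d', deg (del D z) ⟨x, hxz⟩ = d' := ⟨_, rfl⟩
  rw [hk'] at hcard h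
  rw [hm'] at hedges h
  rw [hd'] at hsq hdx
  have hkV : Fintype.card V = k' + 1 := by omega
  have hmD : D.edgeFinset.card = m' + 1 := by omega
  rw [hkV, hmD]
  rw [hkV] at hm hxk
  obtain ⟨j, hj⟩ : ∃ j, k' = j + 10 := ⟨k' - 10, by omega⟩
  subst hj
  have e1 : j + 10 - 4 = j + 6 := by omega
  have e2 : j + 10 + 1 - 6 = j + 5 := by omega
  rw [e1] at h
  rw [e2]
  nlinarith

/-- **A VERTEX OF DEGREE `2`** on the cell `m = 3k − 14`, `k ≥ 11`: deletion onto the `r = 4` cell at `k − 1`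
and the pair lemma `d(x) + d(y) ≤ 2k − 6`. -/
theorem stability_five_three_of_degree_two (D : SimpleGraph V) [DecidableRel D.Adj] (hK : K4mFree D)
    (hk : 11 ≤ Fintype.card V) (hm : D.edgeFinset.card + 14 = 3 * Fintype.card V) {z : V} (hz : deg D z = 2) :
    ∑ v, deg D v * deg D v + 5 * (Fintype.card V - 6) ≤ D.edgeFinset.card * Fintype.card V := by
  have hz' := hz
  unfold deg at hz'
  obtain ⟨x, y, hxy, hN⟩ := card_eq_two.mp hz'
  have hzx : D.Adj z x := by
    have : x ∈ univ.filter (fun w => D.Adj z w) := by rw [hN]; exact mem_insert_self x {y}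
    exact (mem_filter.mp this).2
  have hzy : D.Adj z y := by
    have : y ∈ univ.filter (fun w => D.Adj z w) := by rw [hN]; exact mem_insert_of_mem (mem_singleton_self y)
    exact (mem_filter.mp this).2
  have hnb : ∀ w, D.Adj z w → w = x ∨ w = y := by
    intro w hw
    have : w ∈ univ.filter (fun w => D.Adj z w) := mem_filter.mpr ⟨mem_univ w, hw⟩
    rw [hN, mem_insert, mem_singleton] at this
    exact this
  have hxz : x ≠ z := hzx.ne.symm
  have hyz : y ≠ z := hzy.ne.symm
  have hcard := card_del z
  have hedges := card_edges_del D z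
  rw [hz] at hedges
  have hsq := sum_deg_sq_del D z
  rw [hz] at hsq
  have hsum1 : ∑ a : {v : V // v ≠ z}, (if D.Adj a.1 z then deg (del D z) a else 0) =
      deg (del D z) ⟨x, hxz⟩ + deg (del D z) ⟨y, hyz⟩ := by
    rw [← sum_filter]
    have hfil : univ.filter (fun a : {v : V // v ≠ z} => D.Adj a.1 z) = {⟨x, hxz⟩, ⟨y, hyz⟩} := by
      ext a
      simp only [mem_filter, mem_univ, true_and, mem_insert, mem_singleton]
      constructor
      · intro h
        rcases hnb a.1 (D.adj_symm h) with h' | h'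
        · left; exact Subtype.ext h'
        · right; exact Subtype.ext h'
      · rintro (rfl | rfl)
        · exact D.adj_symm hzx
        · exact D.adj_symm hzy
    rw [hfil, sum_pair]
    intro h
    exact hxy (congrArg Subtype.val h)
  rw [hsum1] at hsq
  have hdx := deg_del D z ⟨x, hxz⟩
  have hdy := deg_del D z ⟨y, hyz⟩
  simp only [D.adj_symm hzx, D.adj_symm hzy, if_true] at hdx hdy
  -- the pair lemma
  have hxy6 := deg_add_deg_add_six_le D hK (by omega) (by omega) hxy
  -- the `r = 4` cell at `k − 1`
  have hK' := k4mFree_del D hK z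
  have h := dense_stability_four_three_ten (del D z) hK' (by omega) (by omega)
  obtain ⟨k', hk'⟩ : ∃ k', Fintype.card {v : V // v ≠ z} = k' := ⟨_, rfl⟩
  obtain ⟨m', hm'⟩ : ∃ m', (del D z).edgeFinset.card = m' := ⟨_, rfl⟩
  obtain ⟨dx, hdx'⟩ : ∃ d', deg (del D z) ⟨x, hxz⟩ = d' := ⟨_, rfl⟩
  obtain ⟨dy, hdy'⟩ : ∃ d', deg (del D z) ⟨y, hyz⟩ = d' := ⟨_, rfl⟩
  rw [hk'] at hcard h
  rw [hm'] at hedges h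
  rw [hdx'] at hsq hdx
  rw [hdy'] at hsq hdy
  have hkV : Fintype.card V = k' + 1 := by omega
  have hmD : D.edgeFinset.card = m' + 2 := by omega
  rw [hkV, hmD]
  rw [hkV] at hm hxy6
  obtain ⟨j, hj⟩ : ∃ j, k' = j + 10 := ⟨k' - 10, by omega⟩
  subst hj
  have e1 : j + 10 - 5 = j + 5 := by omega
  have e2 : j + 10 + 1 - 6 = j + 5 := by omega
  rw [e1] at h
  rw [e2]
  nlinarith

/-- **FIVE BELOW THE DIAGONAL, THE `a = 3` CELLS, EVERY `k ≥ 11`:** `K₄⁻`-free, `m + 14 = 3k` ⇒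
`Σ_v d(v)² + 5 (k − 6) ≤ m k`. -/
theorem dense_stability_five_three (D : SimpleGraph V) [DecidableRel D.Adj] (hK : K4mFree D)
    (hk : 11 ≤ Fintype.card V) (hm : D.edgeFinset.card + 14 = 3 * Fintype.card V) :
    ∑ v, deg D v * deg D v + 5 * (Fintype.card V - 6) ≤ D.edgeFinset.card * Fintype.card V := by
  by_cases hdeg : ∀ z, 3 ≤ deg D z
  · exact dense_stability_five_three_of_min_degree D hK hk hm hdeg
  push Not at hdeg
  obtain ⟨z, hz⟩ := hdeg
  rcases (show deg D z = 0 ∨ deg D z = 1 ∨ deg D z = 2 by omega) with h0 | h1 | h2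
  · exact stability_five_three_of_isolated D hK hk hm h0
  · exact stability_five_three_of_pendant D hK hk hm h1
  · exact stability_five_three_of_degree_two D hK hk hm h2

/-- **FIVE BELOW THE DIAGONAL IS EXACT ON THE `K₄⁻`-FREE CLASS FOR THE CELLS `m = 3 (k − 3) − 5`, EVERY
`k ≥ 11`:** the maximum of `2·Σ_v C(d(v), 2)` is `(3 (k − 3) − 5)(k − 2) − 5 (k − 6)`, attained by `K_{3, k−3}`
minus five edges at one vertex. -/
theorem five_below_diagonal_exact_k4m_three (k : ℕ) (hk : 11 ≤ k) :
    (∀ (D : SimpleGraph (Fin k)) [DecidableRel D.Adj], K4mFree D →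
        D.edgeFinset.card = 3 * (k - 3) - 5 →
        2 * cherries D + 5 * (k - 6) ≤ (3 * (k - 3) - 5) * (k - 2)) ∧
      ∃ (D : SimpleGraph (Fin k)) (_ : DecidableRel D.Adj), K4mFree D ∧
        D.edgeFinset.card = 3 * (k - 3) - 5 ∧ 2 * cherries D + 5 * (k - 6) = (3 * (k - 3) - 5) * (k - 2) := by
  obtain ⟨j, rfl⟩ : ∃ j, k = j + 11 := ⟨k - 11, by omega⟩
  have e1 : 3 * (j + 11 - 3) - 5 = 3 * j + 19 := by omega
  have e2 : j + 11 - 6 = j + 5 := by omega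
  have e3 : j + 11 - 2 = j + 9 := by omega
  rw [e1, e2, e3]
  constructor
  · intro D _ hK hD
    have hcard : Fintype.card (Fin (j + 11)) = j + 11 := Fintype.card_fin _
    have h1 := dense_stability_five_three D hK (by omega) (by omega)
    have h2 := two_mul_cherries_add D
    have h3 := sum_deg_eq D
    rw [hcard, hD, e2] at h1
    rw [hD] at h3
    nlinarith
  · refine ⟨bipMinusStar (j + 11) 3 5, inferInstance, k4mFree_bipMinusStar (j + 11) 3 5, ?_, ?_⟩
    · have := card_edges_bipMinusStar (j + 11) 3 5 (by norm_num) (by omega)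
      have e : j + 11 - 3 = j + 8 := by omega
      rw [e] at this
      omega
    · have h := two_mul_cherries_bipMinusStar (j + 11) 3 5 (by norm_num) (by omega) (by omega)
      have e4 : j + 11 - 3 = j + 8 := by omega
      have e5 : 2 * (j + 11) - 5 - 3 = 2 * j + 14 := by omega
      rw [e4, e5, e3] at h
      nlinarith

end C047

end TriangleCap

end PercRepro
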